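import Mathlib.Analysis.SpecialFunctions.Gaussian.GaussianIntegral
import Mathlib.Analysis.SpecialFunctions.Sqrt
import Literature.Analysis.FluidPDE.RadialCalculus
import HarnessLib

/-!
# Guillod–Šverák, Thm 2.1 (1) as printed in arXiv:1704.00560v1: the radial identity behind the
# explicit eigenfunction `v = ∇φ × e₃`, `φ = erf(|x|/2)/|x|`, `𝓛(0)v = ½v` — kernel-checked part
# (`JiaSverakCAP.GS17SpectrumAtZero`)

HONEST FRAMING (audit cell `pub-nsjs`, file GS17-THM2-COUNTEREXAMPLE.md; papers lane PF-P2, draft §9 E2). This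
module is ONE-VARIABLE CALCULUS plus the radial chain rule of `Literature/Analysis/FluidPDE/RadialCalculus`. It
asserts NOTHING about Navier–Stokes, nothing about the cell's certified profile `Ũ` or its window eigenvalue, and
nothing about Leray–Hopf non-uniqueness; it discharges no paper-level hypothesis of the cell. It kernel-checks
step (i) of an erratum-type observation on a BACKGROUND statement printed in a cited paper, so that the observation
rests on a checked identity rather than on two numerical evaluations.

Guillod–Šverák (J. Math. Fluid Mech. 25 (2023); read here ONLY in arXiv:1704.00560v1: theorem environment TeX
L305–325 (label `thm:spectrum-L`), proof L1015–1029, introduced at L302–304 as following "essentially by the results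
of" Gallay–Wayne 2002 and Jia–Šverák 2015; the journal text is not held) print, for the linearisation at the ZERO
profile `𝓛(0)v = −Δv − ½ x·∇v − ½ v` (their equation (9) — TeX label `eq:def-L`, L289 — at `U = 0`; GŠ sign:
unstable ⇔ `Re λ < 0`) on the divergence-free
class `𝒱 = L² ∩ L⁴` with domain `𝒟`: `σ(𝓛(0)) = {Re λ ≥ 3/4} ∪ {3/2 + n : n ∈ ℕ}`. Reading Gallay–Wayne's
Thm A.1 at `N = 3`, `m = 0` gives instead `{Re λ ≥ 1/4} ∪ {1 + k/2}`; an explicit witness is the smooth,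
axisymmetric, divergence-free, `|x|⁻²`-decaying field `v := ∇φ × e₃`, `φ(x) := erf(|x|/2)/|x|`, which satisfies
`𝓛(0)v = ½ v` with `½ < ¾`, `½ ∉ {3/2 + n}`. The computation has three steps: (i) the RADIAL IDENTITY
`(−Δ − ½ x·∇)φ = ½ φ`, i.e. `φ'' + (2/r)φ' + (r/2)φ' + ½φ = 0` for `r = |x| ≠ 0`; (ii) the commutator
`[x·∇, ∂_j] = −∂_j`, so `x·∇(∇φ × e₃) = ∇(x·∇φ) × e₃ − ∇φ × e₃`, and `Δ(∇φ × e₃) = ∇(Δφ) × e₃`; (iii) hence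
`𝓛(0)v = ∇((−Δ − ½x·∇)φ) × e₃ + ½v − ½v = ½ v` (zero pressure, `div (x·∇v) = 0`).

THIS MODULE KERNEL-CHECKS STEP (i) ONLY, in two forms:
* `coulombGauss_radial_identity`: with `φ = coulombGauss` (`= erf(r/2)/r`, the Gaussian primitive written as an
  interval integral since Mathlib has no `erf`) and its explicit first/second derivatives `coulombGaussD1`,
  `coulombGaussD2` (`hasDerivAt_coulombGauss`, `hasDerivAt_coulombGaussD1`): `φ'' + (2/r) φ' + (r/2) φ' + φ/2 = 0`
  for `r ≠ 0`; also with Lean's `deriv` (`coulombGauss_radial_identity_deriv`).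
* `coulombGauss3_eigen_identity`: on `ℝ³ = EuclideanSpace ℝ (Fin 3)`, for `Φ(x) = φ(‖x‖)` and every `x ≠ 0`:
  `−(ΔΦ)(x) − ½ DΦ(x)[x] = ½ Φ(x)` (`DΦ(x)[x] = fderiv ℝ Φ x x = x·∇Φ(x)`), via `laplacian_comp_norm_sq` and
  `fderiv_comp_norm_sq_apply` of `RadialCalculus`.
* `half_not_mem_printedSpectrum`: `½ ∉ {λ : ℝ | 3/4 ≤ λ} ∪ {3/2 + n}` (arithmetic on the real part).

NOT checked here (hand computations; see the cell file and the PF-P2 draft §9 E2): steps (ii)–(iii), the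
membership `v ∈ 𝒟` (smoothness at `0`, `L² ∩ L⁴` decay of `v` and its derivatives), and anything about the
journal version of the printed statement. The true value `φ(0) = 1/√π` is replaced by Lean's junk value
`erfHalf 0 / 0 = 0` at `r = 0`; every statement below is on `{r ≠ 0}` / `{x ≠ 0}`.

## References

* J. Guillod, V. Šverák, J. Math. Fluid Mech. 25 (2023) = arXiv:1704.00560v1, Thm 2.1 (1) and its proof
  (after Prop. 5.1). [GuillodSverak2023]
* Th. Gallay, C. E. Wayne, Arch. Ration. Mech. Anal. 163 (2002), Appendix A, Thm A.1. [GallayWayne2002]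
* H. Jia, V. Šverák, J. Funct. Anal. 268 (2015), Lemma 2.1 (`σ(L) ⊂ {Re λ ≤ −¼}` on `L²`, JS sign).
  [JiaSverak2015]
-/

noncomputable section

open MeasureTheory Set Filter intervalIntegral InnerProductSpace
open _root_.Topology
open scoped RealInnerProductSpace Laplacian
open Literature.Analysis.FluidPDE

namespace Summit.NavierStokesRegularity.JiaSverakCAP.GS17SpectrumAtZero

/-! ### The profile `φ(r) = erf(r/2)/r` and its derivatives (one-variable calculus) -/

/-- `erfHalf r = erf(r/2) = (2/√π) ∫₀^{r/2} e^{−t²} dt` (Mathlib has no `erf`; the Gaussian primitive is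
an interval integral). [folklore] -/
def erfHalf (r : ℝ) : ℝ :=
  2 / Real.sqrt Real.pi * ∫ t in (0 : ℝ)..(r / 2), Real.exp (-t ^ 2)

/-- `gaussHalf r = e^{−(r/2)²}/√π = e^{−r²/4}/√π`, the derivative of `erfHalf`. [folklore] -/
def gaussHalf (r : ℝ) : ℝ :=
  Real.exp (-(r / 2) ^ 2) / Real.sqrt Real.pi

/-- The radial profile `φ(r) = erf(r/2)/r` ("Coulomb potential of a Gaussian": `−Δφ = (4π)^{−1/2}e^{−r²/4}`
on `ℝ³`); junk value `0` at `r = 0` (Lean's `x / 0 = 0`; the true value there is `1/√π`, never used).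
[folklore] -/
def coulombGauss (r : ℝ) : ℝ :=
  erfHalf r / r

/-- `φ'(r) = gaussHalf r / r − erfHalf r / r²` (`r ≠ 0`). [folklore] -/
def coulombGaussD1 (r : ℝ) : ℝ :=
  gaussHalf r / r - erfHalf r / r ^ 2

/-- `φ''(r) = −gaussHalf r / 2 − 2 gaussHalf r / r² + 2 erfHalf r / r³` (`r ≠ 0`). [folklore] -/
def coulombGaussD2 (r : ℝ) : ℝ :=
  -(gaussHalf r) / 2 - 2 * gaussHalf r / r ^ 2 + 2 * erfHalf r / r ^ 3

/-- `√π ≠ 0`. [folklore] -/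
theorem sqrt_pi_ne_zero : Real.sqrt Real.pi ≠ 0 :=
  (Real.sqrt_pos.2 Real.pi_pos).ne'

/-- `erfHalf' = gaussHalf` (fundamental theorem of calculus + chain rule). [folklore] -/
theorem hasDerivAt_erfHalf (r : ℝ) : HasDerivAt erfHalf (gaussHalf r) r := by
  have hc : Continuous fun t : ℝ => Real.exp (-t ^ 2) := by fun_prop
  have h1 : HasDerivAt (fun u : ℝ => u / 2) (1 / 2) r := (hasDerivAt_id r).div_const 2
  have h2 : HasDerivAt (fun u : ℝ => ∫ t in (0 : ℝ)..u, Real.exp (-t ^ 2)) (Real.exp (-(r / 2) ^ 2))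
      (r / 2) :=
    (hc.integral_hasStrictDerivAt 0 (r / 2)).hasDerivAt
  have h3 := h2.comp r h1
  have h4 := h3.const_mul (2 / Real.sqrt Real.pi)
  have h5 : HasDerivAt erfHalf (2 / Real.sqrt Real.pi * (Real.exp (-(r / 2) ^ 2) * (1 / 2))) r := h4
  refine h5.congr_deriv ?_
  simp only [gaussHalf]
  ring

/-- `gaussHalf' (r) = −(r/2) · gaussHalf r`. [folklore] -/
theorem hasDerivAt_gaussHalf (r : ℝ) : HasDerivAt gaussHalf (-(r / 2) * gaussHalf r) r := by
  have h1 : HasDerivAt (fun u : ℝ => u / 2) (1 / 2) r := (hasDerivAt_id r).div_const 2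
  have h2 : HasDerivAt (fun u : ℝ => u / 2 * (u / 2)) (1 / 2 * (r / 2) + r / 2 * (1 / 2)) r :=
    h1.mul h1
  have h3 : HasDerivAt (fun u : ℝ => -(u / 2 * (u / 2))) (-(1 / 2 * (r / 2) + r / 2 * (1 / 2))) r :=
    h2.neg
  have h4 : HasDerivAt (fun u : ℝ => Real.exp (-(u / 2 * (u / 2))))
      (Real.exp (-(r / 2 * (r / 2))) * -(1 / 2 * (r / 2) + r / 2 * (1 / 2))) r :=
    h3.exp
  have h5 : HasDerivAt (fun u : ℝ => Real.exp (-(u / 2 * (u / 2))) / Real.sqrt Real.pi)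
      (Real.exp (-(r / 2 * (r / 2))) * -(1 / 2 * (r / 2) + r / 2 * (1 / 2)) / Real.sqrt Real.pi) r :=
    h4.div_const _
  -- `gaussHalf` is this function (`(u/2)^2 = u/2 * (u/2)`)
  have heq : gaussHalf = fun u : ℝ => Real.exp (-(u / 2 * (u / 2))) / Real.sqrt Real.pi := by
    funext u
    simp only [gaussHalf, pow_two]
  rw [heq]
  refine h5.congr_deriv ?_
  ring

/-- `φ' = coulombGaussD1` away from `0`. [folklore] -/
theorem hasDerivAt_coulombGauss {r : ℝ} (hr : r ≠ 0) :
    HasDerivAt coulombGauss (coulombGaussD1 r) r := by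
  have h : HasDerivAt (fun u : ℝ => erfHalf u / u)
      ((gaussHalf r * r - erfHalf r * 1) / r ^ 2) r :=
    (hasDerivAt_erfHalf r).div (hasDerivAt_id' r) hr
  have h' : HasDerivAt coulombGauss ((gaussHalf r * r - erfHalf r * 1) / r ^ 2) r := h
  refine h'.congr_deriv ?_
  simp only [coulombGaussD1]
  field_simp

/-- `φ'' = coulombGaussD2` away from `0`, i.e. `coulombGaussD1' = coulombGaussD2`. [folklore] -/
theorem hasDerivAt_coulombGaussD1 {r : ℝ} (hr : r ≠ 0) :
    HasDerivAt coulombGaussD1 (coulombGaussD2 r) r := by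
  have hA : HasDerivAt (fun u : ℝ => gaussHalf u / u)
      ((-(r / 2) * gaussHalf r * r - gaussHalf r * 1) / r ^ 2) r :=
    (hasDerivAt_gaussHalf r).div (hasDerivAt_id' r) hr
  have hp : HasDerivAt (fun u : ℝ => u * u) (1 * r + r * 1) r :=
    (hasDerivAt_id' r).mul (hasDerivAt_id' r)
  have hB : HasDerivAt (fun u : ℝ => erfHalf u / (u * u))
      ((gaussHalf r * (r * r) - erfHalf r * (1 * r + r * 1)) / (r * r) ^ 2) r :=
    (hasDerivAt_erfHalf r).div hp (mul_ne_zero hr hr)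
  have h := hA.sub hB
  have heq : coulombGaussD1 = fun u : ℝ => gaussHalf u / u - erfHalf u / (u * u) := by
    funext u
    simp only [coulombGaussD1, pow_two]
  rw [heq]
  refine h.congr_deriv ?_
  simp only [coulombGaussD2]
  field_simp
  ring

/-- `deriv φ = coulombGaussD1` on `{r ≠ 0}`. [folklore] -/
theorem deriv_coulombGauss {r : ℝ} (hr : r ≠ 0) : deriv coulombGauss r = coulombGaussD1 r :=
  (hasDerivAt_coulombGauss hr).deriv

/-- `deriv (deriv φ) = coulombGaussD2` on `{r ≠ 0}`. [folklore] -/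
theorem deriv_deriv_coulombGauss {r : ℝ} (hr : r ≠ 0) :
    deriv (deriv coulombGauss) r = coulombGaussD2 r := by
  have heq : deriv coulombGauss =ᶠ[𝓝 r] coulombGaussD1 := by
    filter_upwards [isOpen_ne.mem_nhds hr] with s hs
    exact deriv_coulombGauss hs
  rw [heq.deriv_eq]
  exact (hasDerivAt_coulombGaussD1 hr).deriv

/-- **Step (i), the radial identity** `φ'' + (2/r)φ' + (r/2)φ' + ½φ = 0` for `φ = erf(r/2)/r`, `r ≠ 0`;
equivalently `(−Δ − ½x·∇)φ = ½φ` for the radial function `φ(|x|)` on `ℝ³ ∖ {0}` (the radial Laplacian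
being `φ'' + (2/r)φ'` and `x·∇ = r∂ᵣ`). This is the computation behind the eigenvalue `½` of `𝓛(0)` that
contradicts Guillod–Šverák's Thm 2.1 (1) as printed in arXiv:1704.00560v1 (`σ(𝓛(0)) = {Re λ ≥ 3/4} ∪
{3/2 + n}`). [folklore] -/
theorem coulombGauss_radial_identity {r : ℝ} (hr : r ≠ 0) :
    coulombGaussD2 r + 2 / r * coulombGaussD1 r + r / 2 * coulombGaussD1 r + coulombGauss r / 2 = 0 := by
  simp only [coulombGaussD2, coulombGaussD1, coulombGauss]
  field_simp
  ring

/-- The radial identity with Lean's `deriv`: `φ'' + (2/r)φ' + (r/2)φ' + ½φ = 0` on `{r ≠ 0}`.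
[folklore] -/
theorem coulombGauss_radial_identity_deriv {r : ℝ} (hr : r ≠ 0) :
    deriv (deriv coulombGauss) r + 2 / r * deriv coulombGauss r + r / 2 * deriv coulombGauss r +
      coulombGauss r / 2 = 0 := by
  rw [deriv_deriv_coulombGauss hr, deriv_coulombGauss hr]
  exact coulombGauss_radial_identity hr

/-! ### The same identity on `ℝ³`: `−ΔΦ − ½ x·∇Φ = ½ Φ` for `Φ(x) = φ(‖x‖)`, `x ≠ 0` -/

/-- The profile in the variable `s = r²`: `g(s) = φ(√s)`, so that `Φ(x) = g(‖x‖²)` fits the radial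
calculus of `RadialCalculus`. [folklore] -/
def coulombGaussSq (s : ℝ) : ℝ :=
  coulombGauss (Real.sqrt s)

/-- `g'(s) = φ'(√s) · (2√s)⁻¹` (`s > 0`). [folklore] -/
def coulombGaussSqD1 (s : ℝ) : ℝ :=
  coulombGaussD1 (Real.sqrt s) * (2 * Real.sqrt s)⁻¹

/-- `g''(s) = φ''(√s)·(2√s)⁻¹·(2√s)⁻¹ − φ'(√s)·(2·(2√s)⁻¹)/(2√s)²` (`s > 0`). [folklore] -/
def coulombGaussSqD2 (s : ℝ) : ℝ :=
  coulombGaussD2 (Real.sqrt s) * (2 * Real.sqrt s)⁻¹ * (2 * Real.sqrt s)⁻¹ -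
    coulombGaussD1 (Real.sqrt s) * (2 * (2 * Real.sqrt s)⁻¹) / (2 * Real.sqrt s) ^ 2

/-- `Φ(x) = φ(‖x‖) = erf(‖x‖/2)/‖x‖` on `ℝ³`, written as `g(‖x‖²)`. [folklore] -/
def coulombGauss3 (x : EuclideanSpace ℝ (Fin 3)) : ℝ :=
  coulombGaussSq (‖x‖ ^ 2)

/-- `Φ(x) = φ(‖x‖)`. [folklore] -/
theorem coulombGauss3_eq (x : EuclideanSpace ℝ (Fin 3)) : coulombGauss3 x = coulombGauss ‖x‖ := by
  simp only [coulombGauss3, coulombGaussSq, Real.sqrt_sq (norm_nonneg x)]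

/-- `g' = coulombGaussSqD1` on `(0, ∞)`. [folklore] -/
theorem hasDerivAt_coulombGaussSq {s : ℝ} (hs : 0 < s) :
    HasDerivAt coulombGaussSq (coulombGaussSqD1 s) s := by
  have hr : Real.sqrt s ≠ 0 := (Real.sqrt_pos.2 hs).ne'
  have h := (hasDerivAt_coulombGauss hr).comp s (Real.hasDerivAt_sqrt hs.ne')
  have h' : HasDerivAt coulombGaussSq (coulombGaussD1 (Real.sqrt s) * (1 / (2 * Real.sqrt s))) s := h
  refine h'.congr_deriv ?_
  simp only [coulombGaussSqD1, one_div]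

/-- `g'' = coulombGaussSqD2` on `(0, ∞)`, i.e. `coulombGaussSqD1' = coulombGaussSqD2`. [folklore] -/
theorem hasDerivAt_coulombGaussSqD1 {s : ℝ} (hs : 0 < s) :
    HasDerivAt coulombGaussSqD1 (coulombGaussSqD2 s) s := by
  have hr : Real.sqrt s ≠ 0 := (Real.sqrt_pos.2 hs).ne'
  have h2r : (2 : ℝ) * Real.sqrt s ≠ 0 := mul_ne_zero two_ne_zero hr
  have hA : HasDerivAt (fun u : ℝ => coulombGaussD1 (Real.sqrt u))
      (coulombGaussD2 (Real.sqrt s) * (1 / (2 * Real.sqrt s))) s :=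
    (hasDerivAt_coulombGaussD1 hr).comp s (Real.hasDerivAt_sqrt hs.ne')
  have hc : HasDerivAt (fun u : ℝ => 2 * Real.sqrt u) (2 * (1 / (2 * Real.sqrt s))) s :=
    (Real.hasDerivAt_sqrt hs.ne').const_mul 2
  have hB : HasDerivAt (fun u : ℝ => (2 * Real.sqrt u)⁻¹)
      (-(2 * (1 / (2 * Real.sqrt s))) / (2 * Real.sqrt s) ^ 2) s :=
    hc.inv h2r
  have h := hA.mul hB
  have h' : HasDerivAt coulombGaussSqD1
      (coulombGaussD2 (Real.sqrt s) * (1 / (2 * Real.sqrt s)) * (2 * Real.sqrt s)⁻¹ +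
        coulombGaussD1 (Real.sqrt s) * (-(2 * (1 / (2 * Real.sqrt s))) / (2 * Real.sqrt s) ^ 2)) s :=
    h
  refine h'.congr_deriv ?_
  simp only [coulombGaussSqD2, one_div]
  ring

/-- **Step (i) on `ℝ³`**: for `Φ(x) = erf(‖x‖/2)/‖x‖` and every `x ≠ 0`,
`−(ΔΦ)(x) − ½ · DΦ(x)[x] = ½ · Φ(x)`, where `DΦ(x)[x] = fderiv ℝ Φ x x = x·∇Φ(x)`; i.e. `Φ` is a
(smooth, `|x|⁻¹`-decaying) eigenfunction of the scalar operator `−Δ − ½x·∇` on `ℝ³ ∖ {0}` with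
eigenvalue `½`, whence `v = ∇Φ × e₃` is an eigenfunction of Guillod–Šverák's `𝓛(0) = −Δ − ½x·∇ − ½`
with eigenvalue `½` by the hand steps (ii)–(iii) of the module docstring (NOT checked here). Contradicts
Thm 2.1 (1) of arXiv:1704.00560v1 as printed (`½ < ¾`, `½ ∉ {3/2 + n}`: `half_not_mem_printedSpectrum`).
[folklore] -/
theorem coulombGauss3_eigen_identity {x : EuclideanSpace ℝ (Fin 3)} (hx : x ≠ 0) :
    -(Δ coulombGauss3) x - 1 / 2 * fderiv ℝ coulombGauss3 x x = 1 / 2 * coulombGauss3 x := by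
  have hs : 0 < ‖x‖ ^ 2 := by positivity
  have hr : ‖x‖ ≠ 0 := norm_ne_zero_iff.2 hx
  have hsq : Real.sqrt (‖x‖ ^ 2) = ‖x‖ := Real.sqrt_sq (norm_nonneg x)
  -- the radial calculus on the open set of radii `U = (0, ∞)`
  have hg : ∀ σ ∈ Ioi (0 : ℝ), HasDerivAt coulombGaussSq (coulombGaussSqD1 σ) σ :=
    fun σ hσ => hasDerivAt_coulombGaussSq hσ
  have hg₁ : HasDerivAt coulombGaussSqD1 (coulombGaussSqD2 (‖x‖ ^ 2)) (‖x‖ ^ 2) :=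
    hasDerivAt_coulombGaussSqD1 hs
  have hΔ : (Δ (fun w : EuclideanSpace ℝ (Fin 3) => coulombGaussSq (‖w‖ ^ 2))) x =
      4 * coulombGaussSqD2 (‖x‖ ^ 2) * ‖x‖ ^ 2 +
        2 * (Module.finrank ℝ (EuclideanSpace ℝ (Fin 3))) * coulombGaussSqD1 (‖x‖ ^ 2) :=
    laplacian_comp_norm_sq (E := EuclideanSpace ℝ (Fin 3)) isOpen_Ioi hg (z := x) hs hg₁
  have hD : fderiv ℝ (fun w : EuclideanSpace ℝ (Fin 3) => coulombGaussSq (‖w‖ ^ 2)) x x =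
      2 * coulombGaussSqD1 (‖x‖ ^ 2) * ⟪x, x⟫ :=
    fderiv_comp_norm_sq_apply (E := EuclideanSpace ℝ (Fin 3)) (hasDerivAt_coulombGaussSq hs) x
  change -(Δ (fun w : EuclideanSpace ℝ (Fin 3) => coulombGaussSq (‖w‖ ^ 2))) x
      - 1 / 2 * fderiv ℝ (fun w : EuclideanSpace ℝ (Fin 3) => coulombGaussSq (‖w‖ ^ 2)) x x
      = 1 / 2 * coulombGaussSq (‖x‖ ^ 2)
  have h3 : Module.finrank ℝ (EuclideanSpace ℝ (Fin 3)) = 3 := by simp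
  rw [hΔ, hD, h3, real_inner_self_eq_norm_sq]
  -- reduce to the one-variable identity in `r = ‖x‖`
  have hα : 4 * coulombGaussSqD2 (‖x‖ ^ 2) * ‖x‖ ^ 2 + 2 * ((3 : ℕ) : ℝ) * coulombGaussSqD1 (‖x‖ ^ 2) =
      coulombGaussD2 ‖x‖ + 2 / ‖x‖ * coulombGaussD1 ‖x‖ := by
    simp only [coulombGaussSqD2, coulombGaussSqD1, hsq, Nat.cast_ofNat]
    field_simp
    ring
  have hβ : 2 * coulombGaussSqD1 (‖x‖ ^ 2) * ‖x‖ ^ 2 = ‖x‖ * coulombGaussD1 ‖x‖ := by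
    simp only [coulombGaussSqD1, hsq]
    field_simp
  have hγ : coulombGaussSq (‖x‖ ^ 2) = coulombGauss ‖x‖ := by
    simp only [coulombGaussSq, hsq]
  rw [hα, hβ, hγ]
  have hid := coulombGauss_radial_identity hr
  linear_combination (-1 : ℝ) * hid

/-- `½` is not in the printed set `{λ : Re λ ≥ 3/4} ∪ {3/2 + n : n ∈ ℕ}` (real part). [folklore] -/
theorem half_not_mem_printedSpectrum :
    (1 / 2 : ℝ) ∉ {l : ℝ | 3 / 4 ≤ l} ∪ {l : ℝ | ∃ n : ℕ, l = 3 / 2 + n} := by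
  rintro (h | ⟨n, hn⟩)
  · simp only [mem_setOf_eq] at h
    norm_num at h
  · have : (0 : ℝ) ≤ n := n.cast_nonneg
    linarith

end Summit.NavierStokesRegularity.JiaSverakCAP.GS17SpectrumAtZero
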